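import Summits.BirchSwinnertonDyer.BirchSwinnertonDyer.Theorems.ManinLocalTwoThreeRigidityImpliesTower
import Summits.BirchSwinnertonDyer.BirchSwinnertonDyer.Theorems.ManinLocalTwoThreeNoPlusDefectTower
import Summits.BirchSwinnertonDyer.BirchSwinnertonDyer.Theorems.ManinLocalTwoThreeNoThreeTorsionCellTower
import Summits.BirchSwinnertonDyer.BirchSwinnertonDyer.Theorems.ManinLocalTwoThreeNoRationalTwoTorsion
import Summits.BirchSwinnertonDyer.BirchSwinnertonDyer.Theorems.ManinLocalTwoThreeShimuraIndexOfIrreducible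
import Summits.BirchSwinnertonDyer.Rank1Residual.ManinAdditive.ShimuraIndexSignLaws
import Summits.BirchSwinnertonDyer.Rank1Residual.ManinAdditive.ShimuraCuspLifting
import Summits.BirchSwinnertonDyer.Rank1Residual.ManinAdditive.NotTrivialEisensteinLocalisationThree
import Summits.BirchSwinnertonDyer.Rank1Residual.ManinAdditive.KatoCurveKPWitness
import HarnessLib

/-!
# CONSEQUENCES of the tower unit-twist theorem: the cell's edges with a binder `h66 : E-es-66`, `h66 : E-es-66₂` or
# `h135 : E-an-135(3|2)` DISCHARGED BY NAME (E-es-86 / E-es-88 closed; E-es-61 ⟸ E-es-67 alone; `3 ∤ c` / `2 ∤ c` on the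
# torsion-free no-plus-defect cells modulo modularity + Kato's fact + `KatoCurveExists` only)

Summit `BirchSwinnertonDyer`, route `ManinLocalTwoThree` (cell bsd-f2-manin), cruxes C3 `ManinPrimeToThreeAtNine` (stmt-BirchSwinnertonDyer-22968) /
C2 `ManinOddAtFour` (stmt-…-22967).  Prover seat bsd-line-manin23-p2, gen 11.  `…RigidityImpliesTower` (p679277) made E-an-135
`KatoCurve.TowerUnitTwist p` (every prime `p`), E-es-66 `ThreeAdicWitnessOfPlusIndexPrimeToThree` and E-es-66₂ `TwoAdicWitnessOfPlusIndexOdd`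
theorems of the tree.  This file rewrites, BY NAME and without those binders, the edges of the cell that consumed them as hypotheses:

* §1 es laws: **E-es-86 `threeAdicKPWitnessOfPlusIndexPrimeToThree_holds`**, **E-es-88 `threeAdicKPWitnessOfKPZero_holds`** (leaf
  `KatoCurveKPWitness`, edges `e86_of_e66`, `e88_of_e86`); **E-es-61 ⟸ E-es-67** (`threeAdicUnitWitnessOfNoRationalThreeTorsion_of_e67`),
  ⟸ E-es-67♯ (`…_of_sharp`), the residue cut ⟸ E-es-67♯ (`threeAdicUnitWitness_muThree_of_sharp`), E-es-61 ⟸ the four hNT rows ∧ E-es-67♯.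
* §2 pointwise `3`-adic / `2`-adic POLAR WITNESSES with no law at all: Fricke-plus, root number `−1`, a second additive prime `q ≠ 3`,
  `ρ̄₃` irreducible (`Ψ₃` rootless), class `3`-torsion-free up to `3`-isogeny (Katz), no rational `2`-torsion (`4 ∣ N`); the `9 ∥ N`
  μ₃-locus modulo the two Shimura sign laws.
* §3 `3 ∤ c` / `2 ∤ c` on the no-plus-defect cells modulo ONLY modularity `exists_isNewformOf`, Kato's symbol-closure fact and `KatoCurveExists`
  (the LEAD's TURNKEY-an-15/16 chains with the cell law E-an-135 removed).

HONEST FRAMING: compositions of tree theorems; the remaining binders are the printed/named facts shown in each signature; C2, C3, Manin's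
conjecture and BSD are NOT proved by this file.  No definitions, no named facts, no sorry.
-/

set_option autoImplicit false
set_option linter.dupNamespace false

noncomputable section

open scoped Classical MatrixGroups ModularForm

open CongruenceSubgroup Complex WeierstrassCurve Literature.NumberTheory.EllipticCurves
  Literature.NumberTheory.EllipticCurves.ModularForms
open Summit.BirchSwinnertonDyer.Rank1Residual.ManinAdditive.KatoCurve
  Summit.BirchSwinnertonDyer.Rank1Residual.ManinAdditive.CuspidalKummer
  Summit.BirchSwinnertonDyer.Rank1Residual.ManinAdditive.CuspidalKummerThree

namespace Summit.BirchSwinnertonDyer.BirchSwinnertonDyer.Theorems.ManinLocalTwoThree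

/-! ### §1 es laws by name -/

/-- **E-es-86 `ThreeAdicKPWitnessOfPlusIndexPrimeToThree` HOLDS** (⟸ E-es-66, leaf edge `e86_of_e66`). -/
theorem threeAdicKPWitnessOfPlusIndexPrimeToThree_holds : ThreeAdicKPWitnessOfPlusIndexPrimeToThree :=
  e86_of_e66 threeAdicWitnessOfPlusIndexPrimeToThree_holds

/-- **E-es-88 `ThreeAdicKPWitnessOfKPZero` HOLDS** (⟸ E-es-86, leaf edge `e88_of_e86`). -/
theorem threeAdicKPWitnessOfKPZero_holds : ThreeAdicKPWitnessOfKPZero :=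
  e88_of_e86 threeAdicKPWitnessOfPlusIndexPrimeToThree_holds

/-- **E-es-61 ⟸ E-es-67 alone** (`threeAdicUnitWitnessOfNoRationalThreeTorsion_of_plusIndex` with E-es-66 discharged). -/
theorem threeAdicUnitWitnessOfNoRationalThreeTorsion_of_e67 (h67 : PlusIndexPrimeToThreeOfNoRationalThreeTorsion) :
    ThreeAdicUnitWitnessOfNoRationalThreeTorsion :=
  threeAdicUnitWitnessOfNoRationalThreeTorsion_of_plusIndex threeAdicWitnessOfPlusIndexPrimeToThree_holds h67

/-- **E-es-61 ⟸ E-es-67♯ alone** (the LEAD's `…_of_towerUnitTwist_of_sharp` with E-an-135(3) discharged). -/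
theorem threeAdicUnitWitnessOfNoRationalThreeTorsion_of_sharp (h67s : PlusIndexPrimeToThreeOfMuThreeNoRationalThreeTorsion) :
    ThreeAdicUnitWitnessOfNoRationalThreeTorsion :=
  threeAdicUnitWitnessOfNoRationalThreeTorsion_of_towerUnitTwist_of_sharp towerUnitTwist_three h67s

/-- **The residue cut ⟸ E-es-67♯ alone** (`threeAdicUnitWitness_muThree_of_laws` with E-es-66 discharged). -/
theorem threeAdicUnitWitness_muThree_of_sharp (h67s : PlusIndexPrimeToThreeOfMuThreeNoRationalThreeTorsion) :
    ThreeAdicUnitWitnessOfNoRationalThreeTorsionOfMuThree :=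
  threeAdicUnitWitness_muThree_of_laws threeAdicWitnessOfPlusIndexPrimeToThree_holds h67s

/-- **E-es-61 ⟸ the Shimura cusp-lifting law E-an-128 alone** (`…_of_cuspLifting` with E-es-66 discharged). -/
theorem threeAdicUnitWitnessOfNoRationalThreeTorsion_of_cuspLifting' (h : ShimuraThreeForcesRationalThreeTorsion) :
    ThreeAdicUnitWitnessOfNoRationalThreeTorsion :=
  threeAdicUnitWitnessOfNoRationalThreeTorsion_of_cuspLifting threeAdicWitnessOfPlusIndexPrimeToThree_holds h

/-! ### §2 Pointwise polar witnesses, no cell law -/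

section Pointwise

variable (W : WeierstrassCurve ℚ) [W.IsElliptic] [W.IsGloballyMinimal] {N : ℕ} [NeZero N]

/-- **Fricke sign `+1` ⟹ a `3`-adic polar witness** (lattice-optimal `W`, `9 ∣ N`; no law). -/
theorem threeAdicPolarWitness_of_frickePlus' (D : ModularParametrizationData W N)
    (hopt : ∀ z ∈ D.L.lattice, ∃ w ∈ periodLattice D.f, z = D.c * w) (h9 : 3 ^ 2 ∣ N) (hW : IsFrickeEigen N D.f 1) :
    ThreeAdicPolarWitness W W D.f :=
  threeAdicPolarWitness_of_frickePlus threeAdicWitnessOfPlusIndexPrimeToThree_holds W D hopt h9 hW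

omit [NeZero N] in
/-- **Root number `−1` ⟹ a `3`-adic polar witness** at the conductor level (`9 ∣ N_W`; no law). -/
theorem threeAdicPolarWitness_of_rootNumber_eq_neg_one' [NeZero (W.conductorNorm ℤ)]
    (D : ModularParametrizationData W (W.conductorNorm ℤ))
    (hopt : ∀ z ∈ D.L.lattice, ∃ w ∈ periodLattice D.f, z = D.c * w) (h9 : 3 ^ 2 ∣ W.conductorNorm ℤ)
    (hw : W.rootNumber = -1) : ThreeAdicPolarWitness W W D.f :=
  threeAdicPolarWitness_of_rootNumber_eq_neg_one threeAdicWitnessOfPlusIndexPrimeToThree_holds W D hopt h9 hw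

/-- **A second additive prime `q ≠ 3` ⟹ a `3`-adic polar witness** (`9 ∣ N`, `q² ∣ N`; no law). -/
theorem threeAdicPolarWitness_of_sq_dvd_of_ne_three (D : ModularParametrizationData W N)
    (hopt : ∀ z ∈ D.L.lattice, ∃ w ∈ periodLattice D.f, z = D.c * w)
    (h9 : 3 ^ 2 ∣ N) {q : ℕ} (hq : q.Prime) (hq3 : q ≠ 3) (hqN : q ^ 2 ∣ N) : ThreeAdicPolarWitness W W D.f :=
  threeAdicPolarWitness_of_e66_of_sq_dvd threeAdicWitnessOfPlusIndexPrimeToThree_holds W D hopt h9 hq hq3 hqN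

/-- **`Ψ₃` without a rational root (`ρ̄₃` with no rational `3`-isogeny kernel point) ⟹ a `3`-adic polar witness** (`9 ∣ N`; no law).
[cite: Ribet1988Shimura, Thm. 1 and §3] -/
theorem threeAdicPolarWitness_of_forall_not_isRoot_Ψ₃' (D : ModularParametrizationData W N)
    (hopt : ∀ z ∈ D.L.lattice, ∃ w ∈ periodLattice D.f, z = D.c * w)
    (h9 : 3 ^ 2 ∣ N) (hΨ : ∀ x₀ : ℚ, ¬ W.Ψ₃.IsRoot x₀) : ThreeAdicPolarWitness W W D.f :=
  threeAdicPolarWitness_of_forall_not_isRoot_Ψ₃ W threeAdicWitnessOfPlusIndexPrimeToThree_holds D hopt h9 hΨ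

/-- **Class `3`-torsion-free up to `3`-isogeny ⟹ a `3`-adic polar witness** (`9 ∣ N`; Katz; no law). [cite: Katz1980, Thm. 2 (m = ℓ)] -/
theorem threeAdicPolarWitness_of_forall_isogeny_addOrderOf_ne' (D : ModularParametrizationData W N)
    (hopt : ∀ z ∈ D.L.lattice, ∃ w ∈ periodLattice D.f, z = D.c * w) (h9 : 3 ^ 2 ∣ N)
    (h : ∀ (W' : WeierstrassCurve ℚ) [W'.IsElliptic] (g : Isogeny W W'), g.degree ∣ 3 →
      ∀ Q : W'.toAffine.Point, addOrderOf Q ≠ 3) :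
    ThreeAdicPolarWitness W W D.f :=
  threeAdicPolarWitness_of_forall_isogeny_addOrderOf_ne W threeAdicWitnessOfPlusIndexPrimeToThree_holds D hopt h9 h

/-- **No rational `2`-torsion ⟹ a `2`-adic polar witness** (lattice-optimal `W`, `4 ∣ N`; E-an-128₂ and E-es-66₂ both discharged).
[cite: Ribet1988Shimura, Thm. 1 and §3] -/
theorem twoAdicPolarWitness_of_noRationalTwoTorsion'' (D : ModularParametrizationData W N)
    (hopt : ∀ z ∈ D.L.lattice, ∃ w ∈ periodLattice D.f, z = D.c * w)
    (h4 : 2 ^ 2 ∣ N) (hT : ∀ e : ℚ, ¬ W.twoTorsionPolynomial.toPoly.IsRoot e) : TwoAdicPolarWitness W W D.f :=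
  twoAdicPolarWitness_of_noRationalTwoTorsion' W twoAdicWitnessOfPlusIndexOdd_holds D hopt h4 hT

/-- **The `9 ∥ N` μ₃-locus modulo the two Shimura sign laws only** (`threeAdicPolarWitness_of_muThree_nine_not27` with E-es-66 discharged). -/
theorem threeAdicPolarWitness_of_muThree_nine_not27' (hCH : ShimuraCharacterSupportLaw) (hS : MuThreeOptimalSignAtNine)
    (D : ModularParametrizationData W N)
    (hopt : ∀ z ∈ D.L.lattice, ∃ w ∈ periodLattice D.f, z = D.c * w) (h9 : 3 ^ 2 ∣ N) (h27 : ¬ 3 ^ 3 ∣ N)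
    (hμ : HasShortMuThree W D.c) (hT : ∀ X₀ Y₀ : ℚ, ¬ IsShortThreeTorsion W D.c X₀ Y₀) :
    ThreeAdicPolarWitness W W D.f :=
  threeAdicPolarWitness_of_muThree_nine_not27 threeAdicWitnessOfPlusIndexPrimeToThree_holds hCH hS W D hopt h9 h27 hμ hT

end Pointwise

/-! ### §3 `3 ∤ c` / `2 ∤ c` on the no-plus-defect cells modulo modularity, Kato's fact and `KatoCurveExists` only -/

section Manin

variable (W : WeierstrassCurve ℚ) [W.IsElliptic] [W.IsGloballyMinimal] {N : ℕ} [NeZero N]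

/-- **`2 ∤ c` — no rational `2`-torsion, no plus defect at `2`** (`4 ∣ N`, lattice-optimal), modulo `exists_isNewformOf`, Kato's `p = 2`
symbol-closure fact and `KatoCurveExists` — NO cell law (TURNKEY-an-15 ∘ an-16 with E-an-128₂ and E-an-135₂ discharged).
[cite: DiamondShurman2005, Thm. 8.8.1] [cite: Kato2004Asterisque, Thm. 12.5 (shape; the named fact is statement-only)] -/
theorem not_two_dvd_maninConstant_of_noRationalTwoTorsion''
    (hnf : exists_isNewformOf) (hF : kato_isIntegral_twistedSymbolSum_two_symbolClosure) (hK : KatoCurveExists)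
    (D : ModularParametrizationData W N) (hopt : ∀ z ∈ D.L.lattice, ∃ w ∈ periodLattice D.f, z = D.c * w)
    (h4 : 2 ^ 2 ∣ N) (hpd : CuspidalPlusDefectPrimeTo 2 D)
    (hT : ∀ e : ℚ, ¬ W.twoTorsionPolynomial.toPoly.IsRoot e) : ¬ (2 : ℤ) ∣ D.c :=
  not_two_dvd_maninConstant_of_noRationalTwoTorsion_of_towerUnitTwist W hnf hF hK towerUnitTwist_two D hopt h4 hpd hT

/-- **`3 ∤ c` — no short `3`-torsion, no `μ₃`, no plus defect at `3`** (`9 ∣ N`, lattice-optimal), modulo `exists_isNewformOf`, Kato's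
`p = 3` symbol-closure fact and `KatoCurveExists` — NO cell law. [cite: DiamondShurman2005, Thm. 8.8.1]
[cite: Kato2004Asterisque, Thm. 12.5 (shape; the named fact is statement-only)] -/
theorem not_three_dvd_maninConstant_of_no_shortThreeTorsion_of_not_hasShortMuThree
    (hnf : exists_isNewformOf) (hF : kato_isIntegral_twistedSymbolSum_three_symbolClosure) (hK : KatoCurveExists)
    (D : ModularParametrizationData W N) (hopt : ∀ z ∈ D.L.lattice, ∃ w ∈ periodLattice D.f, z = D.c * w)
    (h9 : 3 ^ 2 ∣ N) (hpd : CuspidalPlusDefectPrimeTo 3 D)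
    (hT : ∀ X₀ Y₀ : ℚ, ¬ IsShortThreeTorsion W D.c X₀ Y₀) (hμ : ¬ HasShortMuThree W D.c) : ¬ (3 : ℤ) ∣ D.c :=
  not_three_dvd_maninConstant_of_no_shortThreeTorsion_of_not_hasShortMuThree_of_towerUnitTwist W hnf hF hK towerUnitTwist_three
    D hopt h9 hpd hT hμ

/-- **`3 ∤ c` — no short `3`-torsion, no plus defect at `3`, modulo E-es-67♯** (and `exists_isNewformOf`, Kato's fact, `KatoCurveExists`).
[cite: DiamondShurman2005, Thm. 8.8.1] [cite: Kato2004Asterisque, Thm. 12.5 (shape; the named fact is statement-only)] -/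
theorem not_three_dvd_maninConstant_of_no_shortThreeTorsion_of_sharp
    (hnf : exists_isNewformOf) (hF : kato_isIntegral_twistedSymbolSum_three_symbolClosure) (hK : KatoCurveExists)
    (h67s : PlusIndexPrimeToThreeOfMuThreeNoRationalThreeTorsion)
    (D : ModularParametrizationData W N) (hopt : ∀ z ∈ D.L.lattice, ∃ w ∈ periodLattice D.f, z = D.c * w)
    (h9 : 3 ^ 2 ∣ N) (hpd : CuspidalPlusDefectPrimeTo 3 D)
    (hT : ∀ X₀ Y₀ : ℚ, ¬ IsShortThreeTorsion W D.c X₀ Y₀) : ¬ (3 : ℤ) ∣ D.c :=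
  not_three_dvd_maninConstant_of_no_shortThreeTorsion_of_towerUnitTwist_of_sharp W hnf hF hK towerUnitTwist_three h67s
    D hopt h9 hpd hT

/-- **`3 ∤ c` — class `3`-torsion-free up to `3`-isogeny, no plus defect at `3`** (`9 ∣ N`), modulo `exists_isNewformOf`, Kato's fact and
`KatoCurveExists` — NO cell law. [cite: Katz1980, Thm. 2 (m = ℓ)] [cite: Kato2004Asterisque, Thm. 12.5 (shape; the named fact is statement-only)] -/
theorem not_three_dvd_maninConstant_of_forall_isogeny_addOrderOf_ne
    (hnf : exists_isNewformOf) (hF : kato_isIntegral_twistedSymbolSum_three_symbolClosure) (hK : KatoCurveExists)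
    (D : ModularParametrizationData W N) (hopt : ∀ z ∈ D.L.lattice, ∃ w ∈ periodLattice D.f, z = D.c * w)
    (h9 : 3 ^ 2 ∣ N) (hpd : CuspidalPlusDefectPrimeTo 3 D)
    (h : ∀ (W' : WeierstrassCurve ℚ) [W'.IsElliptic] (g : Isogeny W W'), g.degree ∣ 3 →
      ∀ Q : W'.toAffine.Point, addOrderOf Q ≠ 3) : ¬ (3 : ℤ) ∣ D.c :=
  not_three_dvd_maninConstant_of_forall_isogeny_addOrderOf_ne_of_towerUnitTwist W hnf hF hK towerUnitTwist_three D hopt h9 hpd h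

/-- **`3 ∤ c` — `Ψ₃` rootless, no plus defect at `3`** (`9 ∣ N`), modulo `exists_isNewformOf`, Kato's fact and `KatoCurveExists` — NO cell
law. [cite: Ribet1988Shimura, Thm. 1 and §3] [cite: Kato2004Asterisque, Thm. 12.5 (shape; the named fact is statement-only)] -/
theorem not_three_dvd_maninConstant_of_forall_not_isRoot_Ψ₃
    (hnf : exists_isNewformOf) (hF : kato_isIntegral_twistedSymbolSum_three_symbolClosure) (hK : KatoCurveExists)
    (D : ModularParametrizationData W N) (hopt : ∀ z ∈ D.L.lattice, ∃ w ∈ periodLattice D.f, z = D.c * w)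
    (h9 : 3 ^ 2 ∣ N) (hpd : CuspidalPlusDefectPrimeTo 3 D) (hΨ : ∀ x₀ : ℚ, ¬ W.Ψ₃.IsRoot x₀) : ¬ (3 : ℤ) ∣ D.c :=
  not_three_dvd_maninConstant_of_forall_not_isRoot_Ψ₃_of_towerUnitTwist W hnf hF hK towerUnitTwist_three D hopt h9 hpd hΨ

end Manin

end Summit.BirchSwinnertonDyer.BirchSwinnertonDyer.Theorems.ManinLocalTwoThree

end
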